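import Summits.Langlands.Langlands.Theorems.PicardMuOrdinaryMuOrdinaryFamilyRTThorneWeightData
import Literature.NumberTheory.Automorphic.Qian2022PotentialAutomorphy
import HarnessLib

/-!
# Crux `MuOrdinaryFamilyRT` (stmt-Langlands-13757), line `thorne-minimal-lift`: THORNE-READY companions
# (Defs file no. 5 of the line; interface reshape v6 of the lead's stub `stub_pointAutomorphic`, blueprint
# `Cruxes/MuOrdinaryFamilyRT/Lines/thorne-minimal-lift-pointAutomorphic.md` § 3)

The registered stub `stub_pointAutomorphic` (skeleton v5) takes an ordinary automorphic companion in the form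
`HasOrdinaryCompanion 𝓕 F' hcpt' S' y` (…ThorneDefs § 2).  The blueprint of its proof through the LANDED Thorne fact
`Thorne2017.automorphyLifting_unitary_ordinaryMinimal` (p148560) showed that two properties of the companion `(P^c, r^c)` are
consumed that this interface does not carry, although the wall MF1 (`Missing.hidaOrdinaryCompanions`, Hida theory on the definite
`U(3)`) delivers them:

* (f) `UnramifiedOff F' S' r^c` — `r^c` is unramified outside `S' ∪ {w ∣ 3}` (a member of the Hida family of level `S'`); MF1
  already concludes it, the landed reduction `stub_companions_of` discards it.  Needed because Thorne's minimal case asks `r_ι(π)`,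
  `ρ` and `π` to be unramified at EVERY place of the soluble base change `L` not above `3`, and only potential unramifiedness at the
  finitely many places of `S'` can be killed by the choice of `L` (CHT Lemma 4.1.2).
* (g) `Qian2022.IsAutomorphic ι r^c` — `r^c ≅ r_ι(π^c)` in the characterising sense of HLTT / Qian (compatibility at every place
  over a good rational prime), not merely `CompatibleOff S'` (clause (a)); this is the currency of the tree's soluble base change
  and descent facts (`ACC2023.solubleBaseChange_isAutomorphic`, `solubleDescent_isAutomorphic`).  For the intended witness
  `r^c = r_ι(Π)` it is HLTT Thm A.

No crystallinity clause is added: at `u ∣ 3` of `L` both `ρ_y|L` and `r^c|L` are B-ordinary with diagonal characters EXACTLY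
algebraic on inertia once `L_u` kills the open subgroups of clause (e) / of `IsOrdinaryOfLabelledWeightAt`, and gaps `≥ 2`
make them crystalline (Gee–Geraghty 2012 Lemma 3.1.4 (3), blueprint fact F7).

Contents (definitions + two projections; nothing asserted):
* § 1 `HasThorneCompanion 𝓕 F' hcpt' S' y` := the clauses of `HasOrdinaryCompanion` ∧ (f) ∧ (g); `hasOrdinaryCompanion_of_thorne`.
* § 2 `Missing.hidaOrdinaryCompanionsAut` (MF1ᵃ) := MF1 with (g) added to its conclusion; `hidaOrdinaryCompanions_of_aut`.
* § 3 `T.stub_companionsT` (companions stub, families with weight data, Thorne-ready companions) and `T.stub_thorneLiftT`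
  (pointwise minimal lifting from a Thorne-ready companion: the hypothesis of v5's `T.stub_thorneLift` strengthened, hence a weaker
  statement) — the v6 stubs; reductions in the companion file `…ThorneCompanionAutReduction`.
-/

set_option linter.dupNamespace false

namespace Summit.Langlands.Langlands.Cruxes.MuOrdinaryFamilyRT.ThorneMinimalLift

open scoped NumberField Polynomial Matrix Classical
open Field IsDedekindDomain Polynomial
open Literature.NumberTheory.GaloisRepresentations Literature.NumberTheory.Automorphic
open Summit.Langlands.Langlands.Cruxes.MuOrdinaryFamilyRT.CharZeroDominance

noncomputable section

variable {f : ℤ[X]} {ι : PadicAlgCl 3 ≃+* ℂ} {e : K →+* ℂ} {S₀ : Finset (HeightOneSpectrum (𝓞 K))}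
  {ρC : FramedGaloisRep K (PadicAlgCl 3) 3}

/-! ## 1. Thorne-ready companions -/

/-- **`HasThorneCompanion 𝓕 F' hcpt' S' y` — an ordinary automorphic companion of `ρ_y` over `F'` in THORNE-READY form**:
clauses (a)–(e) of `HasOrdinaryCompanion` verbatim (regular algebraic cuspidal `P^c`, framed `r^c` attached to it off
`S' ∪ 3`, polarized in trace form with the family's exponent, potentially unramified on `S' ∖ 3`, the point `𝔪_R`-adically
continuous and integral, `r^c ≡ ρ_y|Γ_{F'}` entrywise residually, same gap-`≥ 2` ordinary shape at every `w ∣ 3`), AND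
(f) `r^c` unramified outside `S' ∪ {w ∣ 3}` (`UnramifiedOff`), AND (g) `r^c` automorphic in Qian's sense
(`Qian2022.IsAutomorphic ι r^c`: semisimple and `≅ r_ι(π)` for a regular algebraic cuspidal `π`, characterising property at
the places over good rational primes).  Intended witness: as for `HasOrdinaryCompanion` (the weight-`κ(y)` member of the
ordinary Hida family on `U(3)_{F'/F'⁺}` through the base change of the seed), with `r^c = r_ι(Π)` (HLTT Thm A). -/
def HasThorneCompanion (𝓕 : OrdFamily f ι e S₀ ρC)
    (F' : Type) [Field F'] [NumberField F'] [Algebra K F'] [IsGalois ℚ F']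
    (hcpt' : isCompact_glFiniteIntegralLevel 3 F') (S' : Finset (HeightOneSpectrum (𝓞 F')))
    (y : 𝓕.R →+* PadicAlgCl 3) : Prop :=
  ∃ (Pc : CuspidalAutomorphicRepData 3 F' hcpt') (rc : FramedGaloisRep F' (PadicAlgCl 3) 3),
    Pc.1.IsRegularAlgebraic ∧
    -- (a) attached to `P^c` off `S'` and `3`
    (∀ w : HeightOneSpectrum (𝓞 F'), w ∉ S' → ((3 : ℕ) : 𝓞 F') ∉ w.asIdeal →
      IsGaloisCompatibleAt Pc.1 ι rc w) ∧
    -- (b) polarized in trace form with the family's exponent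
    (∀ c : absoluteGaloisGroup ℚ, IsComplexConjugation (algebraMap ℚ ℝ) c →
      ∀ σ : absoluteGaloisGroup F', FramedRep.trace rc (absGaloisOuterConj ℚ F' c σ) =
        algebraMap ℤ_[3] (PadicAlgCl 3) (((GaloisRep.cyclotomicCharacter F' 3 σ) ^ 𝓕.m : ℤ_[3]ˣ) : ℤ_[3]) *
          FramedRep.trace rc σ⁻¹) ∧
    -- (c) potentially unramified at the places of `S'` away from `3`
    (∀ w ∈ S', ((3 : ℕ) : 𝓞 F') ∉ w.asIdeal →
      ∃ U : OpenSubgroup (absoluteGaloisGroup (w.adicCompletion F')),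
        ∀ τ ∈ absInertia (w.adicCompletion F'), τ ∈ U →
          rc (absGaloisRestrict F' (w.adicCompletion F') τ) = 1) ∧
    -- (d) the point is `𝔪_R`-adically continuous and integral, and `r^c ≡ ρ_y|Γ_{F'}` residually, entrywise
    (∀ N : ℕ, ∃ M : ℕ, ∀ r ∈ IsLocalRing.maximalIdeal 𝓕.R ^ M, ‖y r‖ ≤ ((3 : ℝ)⁻¹) ^ N) ∧
    (∀ r : 𝓕.R, ‖y r‖ ≤ 1) ∧
    (∃ g : GL (Fin 3) (PadicAlgCl 3), ∀ (σ : absoluteGaloisGroup F') (i j : Fin 3),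
      ‖(g⁻¹ * rc σ * g).val i j‖ ≤ 1 ∧
      ‖(g⁻¹ * rc σ * g).val i j - (pointRep 𝓕 y (absGaloisRestrict K F' σ)).val i j‖ < 1) ∧
    -- (e) same ordinary shape of the same dominant (gaps ≥ 2) labelled weight at every `w ∣ 3`
    (∀ w : HeightOneSpectrum (𝓞 F'), ((3 : ℕ) : 𝓞 F') ∈ w.asIdeal →
      ∀ art : LocalArtinData (w.adicCompletion F'), art.IsCanonical →
      ∃ wt : LabelledWeight (w.adicCompletion F') (PadicAlgCl 3) 3,
        (∀ τ (i j : Fin 3), i < j → wt τ j + 2 ≤ wt τ i) ∧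
        rc.IsOrdinaryOfLabelledWeightAt w art wt ∧
        ∃ (g : GL (Fin 3) (PadicAlgCl 3)) (U : OpenSubgroup (absoluteGaloisGroup (w.adicCompletion F'))),
          (∀ τ : absoluteGaloisGroup (w.adicCompletion F'),
            IsUpper3 (g⁻¹ * pointRep 𝓕 y (absGaloisRestrict K F' (absGaloisRestrict F' (w.adicCompletion F') τ)) *
              g).val) ∧
          ∀ τw ∈ WeilGroup.inertia (w.adicCompletion F'),
            WeilGroup.toAbsGalois (w.adicCompletion F') τw ∈ U → ∀ i : Fin 3,
              (g⁻¹ * pointRep 𝓕 y (absGaloisRestrict K F'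
                  (absGaloisRestrict F' (w.adicCompletion F') (WeilGroup.toAbsGalois (w.adicCompletion F') τw))) *
                g).val i i = (ordinaryWeightUnit wt i (art.artin τw) : PadicAlgCl 3)) ∧
    -- (f) unramified outside `S' ∪ {w ∣ 3}`
    UnramifiedOff F' S' rc ∧
    -- (g) automorphic in the characterising sense
    Qian2022.IsAutomorphic ι rc

/-- A Thorne-ready companion is an ordinary companion (projection onto clauses (a)–(e)). -/
theorem hasOrdinaryCompanion_of_thorne {𝓕 : OrdFamily f ι e S₀ ρC}
    {F' : Type} [Field F'] [NumberField F'] [Algebra K F'] [IsGalois ℚ F']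
    {hcpt' : isCompact_glFiniteIntegralLevel 3 F'} {S' : Finset (HeightOneSpectrum (𝓞 F'))}
    {y : 𝓕.R →+* PadicAlgCl 3} (h : HasThorneCompanion 𝓕 F' hcpt' S' y) :
    HasOrdinaryCompanion 𝓕 F' hcpt' S' y := by
  obtain ⟨Pc, rc, hreg, ha, hb, hc, hd₁, hd₂, hd₃, he, -, -⟩ := h
  exact ⟨Pc, rc, hreg, ha, hb, hc, hd₁, hd₂, hd₃, he⟩

/-! ## 2. MF1ᵃ — the wall, concluding automorphy in the characterising sense -/

/-- **MF1ᵃ — `Missing.hidaOrdinaryCompanionsAut`: `Missing.hidaOrdinaryCompanions` (…ThorneCompanionsDebts § 1, THE WALL — Hida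
theory on the definite unitary group `U(3)_{F'/F'⁺}` transferred to `GL₃/F'`) with ONE extra conclusion, (g)
`Qian2022.IsAutomorphic ι r` for the companion `r`.**  Same hypotheses, same seed, same intended proof (Geraghty 2019 Prop. 2.5.3 /
Lemma 2.6.4 / Cor. 3.1.4 / Cor. 2.7.8, Labesse 2011, Guerberoff 2011); the companion `r` is `r_{3,ι}(Π)` for the base change `Π`
of the weight-`λ` ordinary eigenform, which has HLTT's characterising property (Harris–Lan–Taylor–Thorne 2016 Thm A; indeed CHT
Prop. 3.4.2 / Shin for RACSDC `Π`) and is semisimple (residually absolutely irreducible), i.e. `Qian2022.IsAutomorphic ι r`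
(`Qian2022.IsAutomorphic.of_hltt`).  ABSENT from the tree for the same reason as MF1 (no algebraic automorphic forms on a
definite unitary group).  [Geraghty, Math. Ann. 373 (2019) §§ 2–3; Gee–Geraghty, Duke 161 (2012) §§ 4–5; Labesse 2011 Cor. 5.3,
Thm. 5.4; Guerberoff 2011 Thm. 2.3; Harris–Lan–Taylor–Thorne, Res. Math. Sci. 3 (2016) Thm. A; Qian, Invent. Math. 231 (2023)
Def. 1.3] -/
def Missing.hidaOrdinaryCompanionsAut : Prop :=
  ∀ (F' : Type) [Field F'] [NumberField F'] [Algebra K F'] [IsGalois ℚ F'] [NumberField.IsCMField F']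
    (ι : PadicAlgCl 3 ≃+* ℂ) (hcpt' : isCompact_glFiniteIntegralLevel 3 F')
    (S' : Finset (HeightOneSpectrum (𝓞 F'))) (m : ℤ),
    UnramifiedOverMaximalReal F' → ThreeSplitFromMaximalReal F' →
    -- THE SEED
    ∀ (P₀ : CuspidalAutomorphicRepData 3 F' hcpt') (r₀ : FramedGaloisRep F' (PadicAlgCl 3) 3),
      P₀.1.IsRegularAlgebraic → r₀.IsResiduallyAbsIrreducible →
      CompatibleOff F' S' P₀ ι r₀ → UnramifiedOff F' S' r₀ → TracePolarized F' m r₀ →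
      PotUnramifiedOn F' S' r₀ → AuxiliaryPlace F' S' r₀ →
      (∀ (σ : absoluteGaloisGroup F') (i j : Fin 3), ‖(r₀ σ).val i j‖ ≤ 1) →
      (∀ w : HeightOneSpectrum (𝓞 F'), ((3 : ℕ) : 𝓞 F') ∈ w.asIdeal →
        ∀ art : LocalArtinData (w.adicCompletion F'), art.IsCanonical →
          ∃ wt₀ : LabelledWeight (w.adicCompletion F') (PadicAlgCl 3) 3,
            wt₀.IsDominant ∧ r₀.IsOrdinaryOfLabelledWeightAt w art wt₀) →
    -- EVERY ADMISSIBLE DOMINANT WEIGHT FAMILY HAS A COMPANION OF EXACTLY THAT WEIGHT, AUTOMORPHIC IN QIAN'S SENSE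
    ∀ (wt : (w : HeightOneSpectrum (𝓞 F')) → LabelledWeight (w.adicCompletion F') (PadicAlgCl 3) 3),
      (∀ w : HeightOneSpectrum (𝓞 F'), ((3 : ℕ) : 𝓞 F') ∈ w.asIdeal → (wt w).IsDominant) →
      (∃ ρ : absoluteGaloisGroup F' →* GL (Fin 3) (PadicAlgCl 3), TracePolarizedHom F' m ρ ∧
        ∀ w : HeightOneSpectrum (𝓞 F'), ((3 : ℕ) : 𝓞 F') ∈ w.asIdeal →
          ∀ art : LocalArtinData (w.adicCompletion F'), art.IsCanonical → IsBorelOfWeightAt F' w art ρ (wt w)) →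
      ∃ (P : CuspidalAutomorphicRepData 3 F' hcpt') (r : FramedGaloisRep F' (PadicAlgCl 3) 3),
        P.1.IsRegularAlgebraic ∧ CompatibleOff F' S' P ι r ∧ UnramifiedOff F' S' r ∧
        TracePolarized F' m r ∧ PotUnramifiedOn F' S' r ∧
        EntrywiseCongruent F' (r : absoluteGaloisGroup F' →* GL (Fin 3) (PadicAlgCl 3)) r₀ ∧
        (∀ w : HeightOneSpectrum (𝓞 F'), ((3 : ℕ) : 𝓞 F') ∈ w.asIdeal →
          ∀ art : LocalArtinData (w.adicCompletion F'), art.IsCanonical →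
            r.IsOrdinaryOfLabelledWeightAt w art (wt w)) ∧
        Qian2022.IsAutomorphic ι r

/-- MF1ᵃ implies MF1 (drop the extra conclusion). -/
theorem hidaOrdinaryCompanions_of_aut : Missing.hidaOrdinaryCompanionsAut → Missing.hidaOrdinaryCompanions := by
  intro h F' _ _ _ _ _ ι hcpt' S' m hunr hsplit P₀ r₀ hP₀ hirr hcompat₀ hunr₀ hpol₀ hpur₀ haux₀ hint₀ hord₀ wt hdom hwit
  obtain ⟨P, r, hP, hcompat, hunrr, hpol, hpurr, hcong, hord, -⟩ :=
    h F' ι hcpt' S' m hunr hsplit P₀ r₀ hP₀ hirr hcompat₀ hunr₀ hpol₀ hpur₀ haux₀ hint₀ hord₀ wt hdom hwit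
  exact ⟨P, r, hP, hcompat, hunrr, hpol, hpurr, hcong, hord⟩

/-! ## 3. The v6 stubs: companions in Thorne-ready form, lifting from Thorne-ready companions -/

/-- **`T.stub_companionsT` — the companions stub for families with weight data, delivering THORNE-READY companions**
(`T.stub_companionsW` of …ThorneWeightData with `HasThorneCompanion` in place of `HasOrdinaryCompanion`; derived in
…ThorneCompanionAutReduction from MF1ᵃ + MF2 + G1). -/
def T.stub_companionsT : Prop :=
  ∀ (f : ℤ[X]) (ι : PadicAlgCl 3 ≃+* ℂ) (e : K →+* ℂ) (S₀ : Finset (HeightOneSpectrum (𝓞 K)))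
    (ρC : FramedGaloisRep K (PadicAlgCl 3) 3) (𝓕 : OrdFamily f ι e S₀ ρC),
    Generic f → PicardInput f ι e S₀ ρC → MainClassPlus f S₀ ρC →
    ((4 : ℕ) : WithBot ℕ∞) ≤ ringKrullDim 𝓕.R → PotUnramifiedFamily 𝓕 → Module.Finite 𝓕.Λ 𝓕.R →
    HasWeightData 𝓕 →
    ∃ (F' : Type) (_ : Field F') (_ : NumberField F') (_ : Algebra K F') (_ : IsGalois ℚ F')
      (hcpt' : isCompact_glFiniteIntegralLevel 3 F') (S' : Finset (HeightOneSpectrum (𝓞 F')))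
      (D : Set (𝓕.Λ →+* PadicAlgCl 3)) (E : IntermediateField ℚ_[3] (PadicAlgCl 3)),
      Module.finrank K F' = 2 ∧ NumberField.IsCMField F' ∧
      ((rbar f 𝓕.B).comp (absGaloisRestrict K F').toMonoidHom).range = (rbar f 𝓕.B).range ∧
      FiniteDimensional ℚ_[3] E ∧
      (∀ w : HeightOneSpectrum (𝓞 F'), w.under (𝓞 K) ∈ S₀ → w ∈ S') ∧
      (∀ κ ∈ D, ∀ a : 𝓕.Λ, κ a ∈ E ∧ ‖κ a‖ ≤ 1) ∧
      (∀ M : ℕ, ∃ κ ∈ D, ∀ a : 𝓕.Λ,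
        ‖κ a - 𝓕.j (𝓕.x (algebraMap 𝓕.Λ 𝓕.R a))‖ ≤ ((3 : ℝ)⁻¹) ^ M) ∧
      ∀ y : 𝓕.R →+* PadicAlgCl 3, y.comp (algebraMap 𝓕.Λ 𝓕.R) ∈ D →
        HasThorneCompanion 𝓕 F' hcpt' S' y

/-- **`T.stub_thorneLiftT` — POINTWISE MINIMAL AUTOMORPHY LIFTING from a THORNE-READY companion** (`T.stub_thorneLift` of
…ThorneDefs § 3 with the hypothesis `HasOrdinaryCompanion` strengthened to `HasThorneCompanion`; hence implied by
`T.stub_thorneLift`).  Intended proof: blueprint `Lines/thorne-minimal-lift-pointAutomorphic.md` — Galois half landed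
(`stub_pointGalois`, p142159); automorphic half = Thorne 2017 Thm 5.1 (landed fact p148560) over a soluble CM `L/F'` (CHT Lemma
4.1.2) for the twist by a CM character `ψ` with `ψψ^c = ε^{-2-m}` (CHT Lemma 4.1.5), crystallinity at `u ∣ 3` by Gee–Geraghty 2012
Lemma 3.1.4 (3), base change / descent by ACC+ Prop. 6.5.13 (tree), untwisting, `ℓ ≠ p` compatibility (Caraiani 2012) and
integrality of `N w · Satake`.  [Thorne Math. Z. 285 (2017) Thm 5.1; CHT 2008 Lemmas 4.1.2, 4.1.5; Gee–Geraghty 2012 Lemma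
3.1.4; ACC+ 2023 Prop. 6.5.13; Caraiani, Duke 161 (2012) Thm 1.1] -/
def T.stub_thorneLiftT : Prop :=
  ∀ (f : ℤ[X]) (ι : PadicAlgCl 3 ≃+* ℂ) (e : K →+* ℂ) (S₀ : Finset (HeightOneSpectrum (𝓞 K)))
    (ρC : FramedGaloisRep K (PadicAlgCl 3) 3) (𝓕 : OrdFamily f ι e S₀ ρC),
    Generic f → PicardInput f ι e S₀ ρC → MainClassPlus f S₀ ρC → PotUnramifiedFamily 𝓕 →
    ∀ (F' : Type) [Field F'] [NumberField F'] [Algebra K F'] [IsGalois ℚ F']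
      (hcpt' : isCompact_glFiniteIntegralLevel 3 F') (S' : Finset (HeightOneSpectrum (𝓞 F'))),
      Module.finrank K F' = 2 → NumberField.IsCMField F' →
      ((rbar f 𝓕.B).comp (absGaloisRestrict K F').toMonoidHom).range = (rbar f 𝓕.B).range →
      (∀ w : HeightOneSpectrum (𝓞 F'), w.under (𝓞 K) ∈ S₀ → w ∈ S') →
    ∀ y : 𝓕.R →+* PadicAlgCl 3, HasThorneCompanion 𝓕 F' hcpt' S' y → IsClassicalOver 𝓕 F' hcpt' S' y

/-- The v5 lifting stub implies the v6 one (stronger hypothesis on the companion). -/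
theorem stub_thorneLiftT_of_thorneLift : T.stub_thorneLift → T.stub_thorneLiftT :=
  fun h f ι e S₀ ρC 𝓕 hgen hin hM hpur F' _ _ _ _ hcpt' S' hdeg hCM hrange hS' y hy =>
    h f ι e S₀ ρC 𝓕 hgen hin hM hpur F' hcpt' S' hdeg hCM hrange hS' y (hasOrdinaryCompanion_of_thorne hy)

end

end Summit.Langlands.Langlands.Cruxes.MuOrdinaryFamilyRT.ThorneMinimalLift
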